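import Mathlib
import Summits.KontsevichZagierPeriods.Zeta5Search.DenomLaw.StarZonePaths
import Summits.KontsevichZagierPeriods.Zeta5Search.RVLargeParamZCoverMid
import HarnessLib

/-!
# ζ(5) search — DENOM-LAW D1: PATH ACCOUNTING on the STAR ZONE is a THEOREM for general `b` (the ∀-`b` node on fam-rv's proved zone)

Cell `pub-zeta5`, track «DENOM-LAW» D1, seat `denom-prover-d1` gen 20 (`HOME/denom-law/prover-d1/ATTEMPT-20.md` §3), part 2 of 2
(part 1 = `DenomLaw/StarZonePaths.lean`, the `C⋆` lemmas).  HONEST FRAMING: systematic search; MODEL/structure side — integer bookkeeping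
plus ONE application of a LANDED theorem of the `fam-rv` lineage, the large-parameter class law (CV⁺) `RVFlatGauge.largeParamClassLaw_holds`
(fam-rv gen 8–10, `RVLargeParamZCoverMid`): with at most one long parameter block, `v_p(Cas_j(b)) ≥ min(1,⌊d/p⌋) − N_p + lpBonus`,
`lpBonus = min(nbig, [LP] + [2p ≤ d])`.  Nothing about ζ(5); no γ; no p-adic digit is computed here; no irrationality claim; records in
print UNMOVED.

## What is proved (kernel-checked), for EVERY sorted `b`
§1 fam-rv's bonus from the witnesses of part 1: `nbig ≥ 1` from `b₁ ≥ p`, `nbig ≥ 2` from `b₁, b₂ ≥ p`, `[LP] = 1` from a heavy long star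
partner (slot `i = 6`), hence `lpBonus ≥ 1` / `≥ 2`.
§2 **`pathAccounting_starZone`** (any admissible direction `j`) and **`pathAccountingFirstPeriod_starZone`** (`j = 7`): the literal conclusion
of `DenomLaw.PathAccountingFirstPeriod` — `v_p(Cas_j(b)) ≥ ⌊d/p⌋ − N_p − min([⌊d/p⌋ ≥ 2], 5 − C⋆)` — for every sorted `b` in the Brown–Zudilin
polytope with `b + e_j` in the polytope and every prime `p ≥ 5` with `p² > b₀ + 2`, on the STAR ZONE `b₀ − 2b₆ < p` (at most the smallest
parameter's block is long) minus the sliver {`b₇ ≥ p` and `b₀ − b₅ − b₇ ≥ p`}.  The first-period hypothesis of the node is not needed.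
Mechanism: `N_p` cancels between the node and (CV⁺); `⌊d/p⌋ ≤ 2` on the zone; `C⋆ ≤ 6` off the sliver; `C⋆ = 6` exhibits the `[LP]` witness
and `nbig ≥ 2`, `C⋆ ≥ 3` gives `nbig ≥ 1` (part 1) — exactly what `lpBonus` pays in each case `(⌊d/p⌋, C⋆)`.  On the sliver (CV⁺) is one
short (`C⋆ = 7`, `lpBonus = 1`): not claimed here (those cells are reached by THEOREM LB in the census).
This is the ∀-`b` node on the whole of fam-rv's proved zone {at most one long block} apart from the sliver: it extends gen 6's
`FirstPeriodKit.pathAccounting_shallow` (`N_p = 0`, `⌊d/p⌋ ≤ 1`) to every star configuration `N_p ≤ 6` and every `⌊d/p⌋`.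
CENSUS (prover-d1 g20, the 114,713 exact first-period instances of g18's kit j267899; p = 5, 7 exhaustive, p = 11, 13 samples of 30,000):
the hypotheses hold on 12,699 instances (11.1 %), the sliver is 1,058 (0.9 %); the ∀-`b` theorems of record so far (gen 6 shallow + the
a = 7 long profiles of gen 16–18) covered ≈ 10 %.
-/

namespace Summit.KontsevichZagierPeriods.Zeta5Search.DenomLaw.StarZone

open Finset
open Summit.KontsevichZagierPeriods.Zeta5Search.CasoratianValuation (InPolytope pairFloors refund shift casoratian)
open Summit.KontsevichZagierPeriods.Zeta5Search.WedgeDictionary (dOf)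
open Summit.KontsevichZagierPeriods.Zeta5Search.DenomLaw (Sorted7 cStar)
open Summit.KontsevichZagierPeriods.Zeta5Search.DenomLaw.FirstPeriodKit (sorted7_chain)
open Summit.KontsevichZagierPeriods.Zeta5Search.RVFlatGauge (largeParamClassLaw_holds)
open Summit.KontsevichZagierPeriods.Zeta5Search.RVFlatGauge.Cap (nbig lpUnit lpBonus lpBonus_nonneg lpUnit_nonneg)

variable {b : ℕ → ℤ} {p : ℕ}

/-! ### §1 fam-rv's bonus from the witnesses -/

/-- `nbig ≥ 1` from `b₁ ≥ p`. -/
theorem one_le_nbig (h1 : (p : ℤ) ≤ b 1) : 1 ≤ nbig b p := by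
  unfold nbig
  exact card_pos.2 ⟨0, by simp [h1]⟩

/-- `nbig ≥ 2` from `b₁, b₂ ≥ p`. -/
theorem two_le_nbig (h1 : (p : ℤ) ≤ b 1) (h2 : (p : ℤ) ≤ b 2) : 2 ≤ nbig b p := by
  unfold nbig
  calc 2 = ({0, 1} : Finset (Fin 7)).card := by decide
    _ ≤ _ := card_le_card fun k hk => by
        simp only [mem_insert, mem_singleton] at hk
        rcases hk with rfl | rfl
        · simpa using h1
        · simpa using h2

/-- `[LP] = 1` from a heavy long star partner (slot `i = 6` is long: `b₀ − 2b₇ ≥ b₀ − b_{k+1} − b₇ ≥ p`). -/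
theorem lpUnit_eq_one (hs : Sorted7 b) {k : ℕ} (hk : k < 6) (hkp : (p : ℤ) ≤ b (k + 1))
    (hks : (p : ℤ) ≤ b 0 - b (k + 1) - b 7) : lpUnit b p = 1 := by
  have h7k : b 7 ≤ b (k + 1) := (sorted7_chain hs).2.2.2.2.2.trans (ge_six hs k hk)
  unfold lpUnit
  rw [if_pos]
  refine ⟨6, by simp, k, mem_range.2 (by omega), by omega, ?_, hkp, ?_⟩
  · show (p : ℤ) ≤ b 0 - 2 * b (6 + 1)
    simp only [Nat.reduceAdd]; linarith
  · show (p : ℤ) ≤ b 0 - b (6 + 1) - b (k + 1)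
    simp only [Nat.reduceAdd]; linarith

/-- `lpBonus ≥ 1` from a heavy long star partner. -/
theorem one_le_lpBonus (hs : Sorted7 b) {k : ℕ} (hk : k < 6) (hkp : (p : ℤ) ≤ b (k + 1))
    (hks : (p : ℤ) ≤ b 0 - b (k + 1) - b 7) : 1 ≤ lpBonus b p := by
  have hn := one_le_nbig (hkp.trans (le_one hs k (by omega)))
  unfold lpBonus
  rw [lpUnit_eq_one hs hk hkp hks]
  refine le_min (by exact_mod_cast hn) ?_
  split_ifs <;> norm_num

/-- `lpBonus ≥ 1` from `b₁ ≥ p` and `2p ≤ d`. -/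
theorem one_le_lpBonus_of_d (h1 : (p : ℤ) ≤ b 1) (h2d : 2 * (p : ℤ) ≤ dOf b) : 1 ≤ lpBonus b p := by
  have hn := one_le_nbig h1
  unfold lpBonus
  rw [if_pos h2d]
  refine le_min (by exact_mod_cast hn) ?_
  have := lpUnit_nonneg b p
  linarith

/-- `lpBonus ≥ 2` from a heavy long star partner, `b₂ ≥ p` and `2p ≤ d`. -/
theorem two_le_lpBonus (hs : Sorted7 b) {k : ℕ} (hk : k < 6) (hkp : (p : ℤ) ≤ b (k + 1))
    (hks : (p : ℤ) ≤ b 0 - b (k + 1) - b 7) (h2 : (p : ℤ) ≤ b 2) (h2d : 2 * (p : ℤ) ≤ dOf b) : 2 ≤ lpBonus b p := by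
  have hn := two_le_nbig (h2.trans (sorted7_chain hs).1) h2
  unfold lpBonus
  rw [lpUnit_eq_one hs hk hkp hks, if_pos h2d]
  exact le_min (by exact_mod_cast hn) (by norm_num)

/-! ### §2 PATH accounting on the star zone -/

/-- **PATH ACCOUNTING ON THE STAR ZONE (any admissible direction `j`)**: the conclusion of `DenomLaw.PathAccountingFirstPeriod` for
every sorted `b` in the polytope with `b + e_j` in the polytope, every prime `p ≥ 5` with `p² > b₀ + 2`, whenever `b₀ − 2b₆ < p`
(at most the smallest parameter's block is long) and not (`b₇ ≥ p` and `b₀ − b₅ − b₇ ≥ p`).  From fam-rv's LANDED (CV⁺)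
`RVFlatGauge.largeParamClassLaw_holds` and the `C⋆` lemmas of `StarZonePaths` (the pair digits `N_p` cancel). -/
theorem pathAccounting_starZone (b : ℕ → ℤ) (p j : ℕ) (hb : InPolytope b) (hs : Sorted7 b) (hj1 : 1 ≤ j) (hj7 : j ≤ 7)
    (hb' : InPolytope (shift b j)) (hprime : p.Prime) (hp5 : 5 ≤ p) (hwin : (b 0 + 2 : ℤ) < (p : ℤ) ^ 2)
    (hz : b 0 - 2 * b 6 < p) (hex : ¬ ((p : ℤ) ≤ b 7 ∧ (p : ℤ) ≤ b 0 - b 5 - b 7)) (hcas : casoratian b j ≠ 0) :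
    dOf b / (p : ℤ) - pairFloors b p - min (if 2 ≤ dOf b / (p : ℤ) then (1 : ℤ) else 0) (5 - (cStar b p : ℤ))
      ≤ padicValRat p (casoratian b j) := by
  have hp0 : (0 : ℤ) < p := by exact_mod_cast hprime.pos
  have hcv := largeParamClassLaw_holds b j p 6 hb hj1 hj7 hb' hprime hp5 hwin (short_blocks hs hz) hcas
  unfold refund at hcv
  have hd0 : 0 ≤ dOf b := by have := hb.2.2; unfold dOf; linarith
  have hfd0 : 0 ≤ dOf b / (p : ℤ) := Int.ediv_nonneg hd0 hp0.le
  have hfd3 : dOf b / (p : ℤ) < 3 := (Int.ediv_lt_iff_lt_mul hp0).2 (by linarith [dOf_lt_three_p hb hs hz])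
  have hW6 : cStar b p ≤ 6 := cStar_le_six hs hz hex
  have hB0 : 0 ≤ lpBonus b p := lpBonus_nonneg b p
  have h2d : 2 ≤ dOf b / (p : ℤ) → 2 * (p : ℤ) ≤ dOf b := fun h => (Int.le_ediv_iff_mul_le hp0).1 h
  set fd := dOf b / (p : ℤ) with hfd
  by_cases hle : 2 ≤ fd
  · -- ⌊d/p⌋ = 2
    rw [min_eq_left (by omega : (1 : ℤ) ≤ fd)] at hcv
    rw [if_pos hle]
    by_cases hW4 : cStar b p ≤ 4
    · have : (cStar b p : ℤ) ≤ 4 := by exact_mod_cast hW4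
      rw [min_eq_left (by omega)]; linarith
    · by_cases hW5 : cStar b p = 5
      · have h1 := one_le_lpBonus_of_d (heavy_of_cStar_three hs hz (by omega)) (h2d hle)
        have : (cStar b p : ℤ) = 5 := by exact_mod_cast hW5
        rw [min_eq_right (by omega)]; linarith
      · have hW6' : cStar b p = 6 := by omega
        obtain ⟨⟨k, hk, hkp, hks⟩, hb2⟩ := witness_of_cStar_six hs hz (by omega)
        have h2 := two_le_lpBonus hs hk hkp hks hb2 (h2d hle)
        have : (cStar b p : ℤ) = 6 := by exact_mod_cast hW6'
        rw [min_eq_right (by omega)]; linarith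
  · -- ⌊d/p⌋ ≤ 1
    rw [min_eq_right (by omega : fd ≤ 1)] at hcv
    rw [if_neg hle]
    by_cases hW5 : cStar b p ≤ 5
    · have : (cStar b p : ℤ) ≤ 5 := by exact_mod_cast hW5
      rw [min_eq_left (by omega)]; linarith
    · have hW6' : cStar b p = 6 := by omega
      obtain ⟨⟨k, hk, hkp, hks⟩, -⟩ := witness_of_cStar_six hs hz (by omega)
      have h1 := one_le_lpBonus hs hk hkp hks
      have : (cStar b p : ℤ) = 6 := by exact_mod_cast hW6'
      rw [min_eq_right (by omega)]; linarith

/-- **PATH ACCOUNTING ON THE STAR ZONE, the node's direction `j = 7`** (`DenomLaw.PathAccountingFirstPeriod`'s own binders; its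
first-period hypothesis is not needed): every sorted `b` in the polytope with `b + e₇` in the polytope, every prime `p ≥ 5` with
`p² > b₀ + 2`, on `b₀ − 2b₆ < p` off the sliver {`b₇ ≥ p`, `b₀ − b₅ − b₇ ≥ p`}. -/
theorem pathAccountingFirstPeriod_starZone (b : ℕ → ℤ) (p : ℕ) (hb : InPolytope b) (hs : Sorted7 b)
    (hb' : InPolytope (shift b 7)) (hprime : p.Prime) (hp5 : 5 ≤ p) (hwin : (b 0 + 2 : ℤ) < (p : ℤ) ^ 2)
    (hz : b 0 - 2 * b 6 < p) (hex : ¬ ((p : ℤ) ≤ b 7 ∧ (p : ℤ) ≤ b 0 - b 5 - b 7)) (hcas : casoratian b 7 ≠ 0) :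
    dOf b / (p : ℤ) - pairFloors b p - min (if 2 ≤ dOf b / (p : ℤ) then (1 : ℤ) else 0) (5 - (cStar b p : ℤ))
      ≤ padicValRat p (casoratian b 7) :=
  pathAccounting_starZone b p 7 hb hs (by norm_num) le_rfl hb' hprime hp5 hwin hz hex hcas

end Summit.KontsevichZagierPeriods.Zeta5Search.DenomLaw.StarZone
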